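import Mathlib.Topology.Sheaves.Flasque
import Mathlib.Topology.Sheaves.Abelian
import Mathlib.CategoryTheory.Generator.Sheaf
import Mathlib.CategoryTheory.Preadditive.Injective.Basic
import Mathlib.CategoryTheory.Limits.Constructions.EpiMono
import Mathlib.CategoryTheory.Sites.SheafCohomology.Basic
import Mathlib.CategoryTheory.Abelian.GrothendieckCategory.HasExt
import Mathlib.Algebra.Homology.DerivedCategory.Ext.ExactSequences
import HarnessLib

/-!
# Flasque sheaves are acyclic: injective ⇒ flasque (Hartshorne III.2.4) and `H^i(X, ℱ) = 0` for
`ℱ` flasque and `i > 0` (Hartshorne III.2.5)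

Topic: `Literature/AlgebraicGeometry/Motives` (support file for `GrothendieckVanishing.lean` /
`Differentials.lean`: the first two links of the chain of results of Hartshorne, *Algebraic Geometry*,
III.2 leading to Grothendieck's vanishing theorem III.2.7, proved here in Mathlib's setting).

Setting. `X : TopCat.{u}`; sheaves of abelian groups on `X` are the objects of
`Sheaf (Opens.grothendieckTopology X) AddCommGrpCat.{u}` (definitionally Mathlib's
`TopCat.Sheaf AddCommGrpCat X`); sheaf cohomology is Mathlib's `Sheaf.H F n = Ext^n(ℤ_X, F)` (`Ext` in
this Grothendieck abelian category, from the constant sheaf `ℤ_X`); flasque means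
`TopCat.Sheaf.IsFlasque` (all restriction maps are epimorphisms, i.e. surjective).

Main results (all in `namespace Literature`):

* `isSplitMono_sigmaMap'`, `Presheaf.exists_freeYonedaMap`, `Sheaf.exists_mono_freeYonedaMap`:
  for a monomorphism `f : V ⟶ U` in a site `(C, J)`, the induced morphism of "free abelian sheaves on
  representables" `ℤ[h_V] ⊗ M ⟶ ℤ[h_U] ⊗ M` (Mathlib's `Sheaf.freeYoneda J V M ⟶ Sheaf.freeYoneda J U M`)
  is a monomorphism, and under `Sheaf.freeYonedaHomEquiv : (freeYoneda J U M ⟶ F) ≃ (M ⟶ F(U))`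
  precomposition with it is restriction `F(U) ⟶ F(V)`. (For opens `V ≤ U` of `X` and `M = ℤ` this is
  the inclusion `ℤ_V ↪ ℤ_U` of Hartshorne's proof of III.2.4.)
* `isFlasque_of_injective` (**Hartshorne III.2.4**, for sheaves of abelian groups): an injective abelian
  sheaf is flasque — the restriction `I(U) → I(V)` is even a split epimorphism, a section being
  obtained by extending `ℤ[h_V] ⊗ I(V) → I` along the mono `ℤ[h_V] ⊗ I(V) ↪ ℤ[h_U] ⊗ I(V)`.
* `Ext.subsingleton_X₂`, `Ext.subsingleton_X₁`, `Ext.subsingleton_X₃`: two-out-of-three vanishing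
  lemmas read off the long exact `Ext(A, ·)`-sequence of a short exact sequence (Mathlib's
  `Ext.covariant_sequence_exact₁/₂/₃`), the form in which "the long exact sequence of cohomology" is
  used in III.2.5, III.2.7 and III.2.10.
* `surjective_app_of_shortExact`, `isFlasque_of_shortExact` (Hartshorne II, Ex. 1.16(b),(c), which
  are Mathlib's `IsFlasque.epi_of_shortExact`, `IsFlasque.of_shortExact_of_isFlasque₁₂`, restated for
  short exact sequences in `Sheaf J AddCommGrpCat`), `exists_H_zero_comp_eq` (surjectivity of
  `H⁰(X, 𝒢) → H⁰(X, ℋ)` for `0 → ℱ → 𝒢 → ℋ → 0` with `ℱ` flasque) and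
  `subsingleton_H_one_iff_surjective` (`H¹(X, ℱ) = 0 ↔ Γ(X, 𝒢) → Γ(X, ℋ)` surjective, when
  `H¹(X, 𝒢) = 0`).
* `subsingleton_H_succ_of_isFlasque`, `subsingleton_H_of_isFlasque` (**Hartshorne III.2.5**):
  `H^i(X, ℱ) = 0` for `ℱ` flasque and `i > 0`, by the printed argument: embed `ℱ` in an injective `ℐ`
  (enough injectives in a Grothendieck abelian category), `ℐ` is flasque (III.2.4), so is the quotient
  `𝒢` (II, Ex. 1.16(c)), `Γ(X, ℐ) → Γ(X, 𝒢)` is onto (II, Ex. 1.16(b)) and `H^i(X, ℐ) = 0` for `i > 0`,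
  whence `H¹(X, ℱ) = 0` and `H^i(X, ℱ) ≅ H^{i-1}(X, 𝒢)`, and induction on `i`.

## References

* R. Hartshorne, *Algebraic Geometry*, GTM 52, Springer (1977), doi:10.1007/978-1-4757-3849-0,
  II, Ex. 1.16 (p. 67) and III.2, Lemma 2.4, Prop. 2.5 (pp. 207–208; PDF pp. 262–263). [Hartshorne1977]
-/

open CategoryTheory Limits Opposite TopologicalSpace Abelian

universe w v' v u' u

namespace Literature.AlgebraicGeometry.Motives

/-! ### Split monomorphisms between coproducts of copies of one object -/

section SplitMono

variable {A : Type u'} [Category.{v'} A] [HasZeroMorphisms A]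

/-- In a category with zero morphisms, the morphism `∐_{a : α} M ⟶ ∐_{b : β} M` induced by an
injective map of index sets `p : α → β` (each summand mapping identically to the summand of index
`p a`) is a split monomorphism: a retraction sends the summand of index `p a` back to the summand of
index `a` and the other summands to `0`. [folklore] -/
theorem isSplitMono_sigmaMap' {α β : Type w} (M : A) [HasCoproduct (fun _ : α => M)]
    [HasCoproduct (fun _ : β => M)] (p : α → β) (hp : Function.Injective p) :
    IsSplitMono (Sigma.map' p (fun _ => 𝟙 M) : (∐ fun _ : α => M) ⟶ ∐ fun _ : β => M) := by
  classical
  refine IsSplitMono.mk' ⟨Sigma.desc (fun b => if h : ∃ a, p a = b then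
    Sigma.ι (fun _ : α => M) h.choose else 0), ?_⟩
  refine Sigma.hom_ext _ _ (fun a => ?_)
  have h : ∃ a', p a' = p a := ⟨a, rfl⟩
  rw [Sigma.ι_comp_map'_assoc, Category.id_comp, Sigma.ι_desc, Category.comp_id, dif_pos h,
    hp h.choose_spec]

end SplitMono

/-! ### Functoriality in `U` of the free (pre)sheaf `ℤ[h_U] ⊗ M` -/

section FreeYoneda

variable {C : Type u} [Category.{v} C] {A : Type u'} [Category.{v'} A] [HasCoproducts.{v} A]

/-- For a morphism `f : V ⟶ U` of `C` and an object `M`, the morphism of presheaves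
`Presheaf.freeYoneda V M ⟶ Presheaf.freeYoneda U M` (on an object `W` these presheaves are
`∐_{W ⟶ V} M` and `∐_{W ⟶ U} M`) given on `W` by reindexing along postcomposition with `f`.
Stated as an existence result (this file only records theorems). [folklore] -/
theorem Presheaf.exists_freeYonedaMap {V U : C} (f : V ⟶ U) (M : A) :
    ∃ ι : Presheaf.freeYoneda V M ⟶ Presheaf.freeYoneda U M,
      ∀ W, ι.app W = Sigma.map' (fun φ : (yoneda.obj V).obj W => φ ≫ f) (fun _ => 𝟙 M) := by
  refine ⟨{ app W := Sigma.map' (fun φ : (yoneda.obj V).obj W => φ ≫ f) (fun _ => 𝟙 M),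
            naturality := ?_ }, fun W => rfl⟩
  intro W W' g
  dsimp [Presheaf.freeYoneda]
  rw [Sigma.map'_comp_map', Sigma.map'_comp_map']
  exact Sigma.map'_eq (by funext φ; simp) (fun _ => by simp)

variable (J : GrothendieckTopology C) [HasWeakSheafify J A]

set_option backward.isDefEq.respectTransparency false in
/-- For a monomorphism `f : V ⟶ U` of a site `(C, J)` and an object `M` of a category `A` with zero
morphisms whose sheafification preserves monomorphisms (e.g. `A = AddCommGrpCat`), there is a
monomorphism of sheaves `ι : Sheaf.freeYoneda J V M ⟶ Sheaf.freeYoneda J U M` (the sheafification of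
`Presheaf.exists_freeYonedaMap`; for opens `V ⊆ U` of a space and `M = ℤ` this is `ℤ_V ↪ ℤ_U`) such
that, under the bijections `Sheaf.freeYonedaHomEquiv : (freeYoneda J U M ⟶ F) ≃ (M ⟶ F(U))`,
precomposition with `ι` is postcomposition with the restriction map `F(U) ⟶ F(V)`.
(Hartshorne, *Algebraic Geometry*, proof of III.2.4: `𝒪_V ↪ 𝒪_U` and `Hom(𝒪_U, ℐ) = ℐ(U)`.) [folklore] -/
theorem Sheaf.exists_mono_freeYonedaMap [HasZeroMorphisms A]
    [(presheafToSheaf J A).PreservesMonomorphisms] {V U : C} (f : V ⟶ U) [Mono f] (M : A) :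
    ∃ ι : Sheaf.freeYoneda J V M ⟶ Sheaf.freeYoneda J U M, Mono ι ∧
      ∀ (F : Sheaf J A) (ψ : Sheaf.freeYoneda J U M ⟶ F),
        Sheaf.freeYonedaHomEquiv (ι ≫ ψ) = Sheaf.freeYonedaHomEquiv ψ ≫ F.obj.map f.op := by
  obtain ⟨ι₀, hι₀⟩ := Presheaf.exists_freeYonedaMap f M
  haveI : ∀ W, Mono (ι₀.app W) := fun W => by
    rw [hι₀]
    exact (isSplitMono_sigmaMap' M _ (fun φ φ' h => (cancel_mono f).mp h)).mono
  haveI : Mono ι₀ := NatTrans.mono_of_mono_app ι₀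
  refine ⟨(presheafToSheaf J A).map ι₀, (presheafToSheaf J A).map_mono ι₀, fun F ψ => ?_⟩
  change Presheaf.freeYonedaHomEquiv ((sheafificationAdjunction J A).homEquiv _ F
      ((presheafToSheaf J A).map ι₀ ≫ ψ)) =
    Presheaf.freeYonedaHomEquiv ((sheafificationAdjunction J A).homEquiv _ F ψ) ≫ F.obj.map f.op
  rw [Adjunction.homEquiv_naturality_left]
  generalize ((sheafificationAdjunction J A).homEquiv _ F) ψ = χ
  simp only [Presheaf.freeYonedaHomEquiv, Equiv.coe_fn_mk, NatTrans.comp_app, hι₀, Category.assoc]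
  change _ = _ ≫ _ ≫ ((sheafToPresheaf J A).obj F).map f.op
  rw [← χ.naturality, Presheaf.freeYoneda_map, Sigma.ι_comp_map'_assoc]
  simp

end FreeYoneda

/-! ### Hartshorne III.2.4: injective abelian sheaves are flasque -/

section Injective

variable {X : TopCat.{u}}

/-- **Hartshorne III.2.4** (for sheaves of abelian groups, i.e. for the ringed space `(X, ℤ)`): an
injective object `ℐ` of the category of sheaves of abelian groups on a topological space `X` is
flasque. Proof as printed: for opens `V ⊆ U`, maps `ℤ_U → ℐ` are sections `ℐ(U)` (here with `ℤ`
replaced by the group `M = ℐ(V)`, via `Sheaf.freeYonedaHomEquiv`), and every map `ℤ_V → ℐ` extends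
along the mono `ℤ_V ↪ ℤ_U` since `ℐ` is injective; so `ℐ(U) → ℐ(V)` is (split) surjective.
[cite: Hartshorne1977, III.2.4] -/
theorem isFlasque_of_injective (I : Sheaf (Opens.grothendieckTopology X) AddCommGrpCat.{u})
    [Injective I] : TopCat.Sheaf.IsFlasque I where
  epi {U V} i := by
    obtain ⟨ι, hι, hnat⟩ :=
      Sheaf.exists_mono_freeYonedaMap (Opens.grothendieckTopology X) i.unop (I.obj.obj V)
    obtain ⟨ψ, hψ⟩ := Injective.factors (Sheaf.freeYonedaHomEquiv.symm (𝟙 (I.obj.obj V))) ι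
    have h : Sheaf.freeYonedaHomEquiv ψ ≫ I.obj.map i = 𝟙 _ := by
      rw [← Quiver.Hom.op_unop i, ← hnat, hψ, Equiv.apply_symm_apply]
    exact (IsSplitEpi.mk' ⟨_, h⟩).epi

end Injective

/-! ### Two-out-of-three vanishing along the long exact `Ext`-sequence -/

section ExtSequence

variable {C : Type u} [Category.{v} C] [Abelian C] [HasExt.{w} C] (A : C) {S : ShortComplex C}
  (hS : S.ShortExact)

include hS

/-- For a short exact `0 → X₁ → X₂ → X₃ → 0` and any object `A`, if `Extⁿ(A, X₁) = 0` and
`Extⁿ(A, X₃) = 0` then `Extⁿ(A, X₂) = 0` (exactness of `Extⁿ(A, X₁) → Extⁿ(A, X₂) → Extⁿ(A, X₃)`).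
[folklore] -/
theorem Ext.subsingleton_X₂ (n : ℕ) [Subsingleton (Ext A S.X₁ n)] [Subsingleton (Ext A S.X₃ n)] :
    Subsingleton (Ext A S.X₂ n) := by
  refine subsingleton_of_forall_eq 0 fun x => ?_
  obtain ⟨x₁, rfl⟩ := Ext.covariant_sequence_exact₂ A hS x (Subsingleton.elim _ _)
  rw [Subsingleton.elim x₁ 0, Ext.zero_comp]

/-- For a short exact `0 → X₁ → X₂ → X₃ → 0` and any object `A`, if `Extⁿ(A, X₃) = 0` and
`Extⁿ⁺¹(A, X₂) = 0` then `Extⁿ⁺¹(A, X₁) = 0` (exactness of `Extⁿ(A, X₃) → Extⁿ⁺¹(A, X₁) → Extⁿ⁺¹(A, X₂)`).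
[folklore] -/
theorem Ext.subsingleton_X₁ (n : ℕ) [Subsingleton (Ext A S.X₃ n)] [Subsingleton (Ext A S.X₂ (n + 1))] :
    Subsingleton (Ext A S.X₁ (n + 1)) := by
  refine subsingleton_of_forall_eq 0 fun x => ?_
  obtain ⟨x₃, rfl⟩ := Ext.covariant_sequence_exact₁ A hS x (Subsingleton.elim _ _) rfl
  rw [Subsingleton.elim x₃ 0, Ext.zero_comp]

/-- For a short exact `0 → X₁ → X₂ → X₃ → 0` and any object `A`, if `Extⁿ(A, X₂) = 0` and
`Extⁿ⁺¹(A, X₁) = 0` then `Extⁿ(A, X₃) = 0` (exactness of `Extⁿ(A, X₂) → Extⁿ(A, X₃) → Extⁿ⁺¹(A, X₁)`).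
[folklore] -/
theorem Ext.subsingleton_X₃ (n : ℕ) [Subsingleton (Ext A S.X₂ n)] [Subsingleton (Ext A S.X₁ (n + 1))] :
    Subsingleton (Ext A S.X₃ n) := by
  refine subsingleton_of_forall_eq 0 fun x => ?_
  obtain ⟨x₂, rfl⟩ := Ext.covariant_sequence_exact₃ A hS x rfl (Subsingleton.elim _ _)
  rw [Subsingleton.elim x₂ 0, Ext.zero_comp]

end ExtSequence

/-! ### Short exact sequences with a flasque kernel (Hartshorne II, Ex. 1.16(b),(c)) -/

section FlasqueShortExact

variable {X : TopCat.{u}} {S : ShortComplex (Sheaf (Opens.grothendieckTopology X) AddCommGrpCat.{u})}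
  (hS : S.ShortExact)

include hS

/-- **Hartshorne II, Ex. 1.16(b)** (Mathlib's `TopCat.Sheaf.IsFlasque.epi_of_shortExact`, restated
for a short exact sequence `0 → ℱ → 𝒢 → ℋ → 0` in `Sheaf (Opens.grothendieckTopology X) AddCommGrpCat`):
if `ℱ` is flasque then `𝒢(U) → ℋ(U)` is surjective for every open `U`.
[cite: Hartshorne1977, II Ex. 1.16(b)] -/
theorem surjective_app_of_shortExact [TopCat.Sheaf.IsFlasque S.X₁] (U : Opens X) :
    Function.Surjective (S.g.hom.app (op U)) :=
  (AddCommGrpCat.epi_iff_surjective _).mp (TopCat.Sheaf.IsFlasque.epi_of_shortExact (X := X)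
    (U := U) (S := ShortComplex.mk (C := TopCat.Sheaf AddCommGrpCat.{u} X) S.f S.g S.zero) hS)

/-- **Hartshorne II, Ex. 1.16(c)** (Mathlib's `TopCat.Sheaf.IsFlasque.of_shortExact_of_isFlasque₁₂`,
restated for `Sheaf (Opens.grothendieckTopology X) AddCommGrpCat`): in a short exact sequence
`0 → ℱ → 𝒢 → ℋ → 0` with `ℱ` and `𝒢` flasque, `ℋ` is flasque.
[cite: Hartshorne1977, II Ex. 1.16(c)] -/
theorem isFlasque_of_shortExact [TopCat.Sheaf.IsFlasque S.X₁] [TopCat.Sheaf.IsFlasque S.X₂] :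
    TopCat.Sheaf.IsFlasque S.X₃ :=
  TopCat.Sheaf.IsFlasque.of_shortExact_of_isFlasque₁₂ (X := X)
    (S := ShortComplex.mk (C := TopCat.Sheaf AddCommGrpCat.{u} X) S.f S.g S.zero) hS

/-- For a short exact sequence `0 → ℱ → 𝒢 → ℋ → 0` of abelian sheaves with `ℱ` flasque,
`H⁰(X, 𝒢) → H⁰(X, ℋ)` is surjective (II, Ex. 1.16(b) at `U = X`, transported along Mathlib's
`Sheaf.H.equiv₀ : H⁰(X, ·) ≃ Γ(X, ·)`). [cite: Hartshorne1977, II Ex. 1.16(b)] -/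
theorem exists_H_zero_comp_eq [TopCat.Sheaf.IsFlasque S.X₁] (x₃ : S.X₃.H 0) :
    ∃ x₂ : S.X₂.H 0, x₂.comp (Ext.mk₀ S.g) (add_zero 0) = x₃ := by
  obtain ⟨t, ht⟩ := surjective_app_of_shortExact hS ⊤ (Sheaf.H.equiv₀ S.X₃ isTerminalTop x₃)
  refine ⟨(Sheaf.H.equiv₀ S.X₂ isTerminalTop).symm t, ?_⟩
  rw [← Sheaf.H.map_apply, Sheaf.H.equiv₀_symm_naturality, ht, AddEquiv.symm_apply_apply]

omit hS in
/-- For a short exact sequence `0 → ℱ → 𝒢 → ℋ → 0` of abelian sheaves with `H¹(X, 𝒢) = 0` (e.g. `𝒢`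
flasque, III.2.5, or injective), `H¹(X, ℱ) = 0` if and only if `Γ(X, 𝒢) → Γ(X, ℋ)` is surjective
(exactness of `H⁰(X, 𝒢) → H⁰(X, ℋ) → H¹(X, ℱ) → H¹(X, 𝒢)`; the step "`H¹(X, ℱ) = 0`" of the proof of
III.2.5, and the degree-one case of III.2.10). [cite: Hartshorne1977, III.2.5 (proof)] -/
theorem subsingleton_H_one_iff_surjective (hS : S.ShortExact) [Subsingleton (S.X₂.H 1)] :
    Subsingleton (S.X₁.H 1) ↔ Function.Surjective (S.g.hom.app (op ⊤)) := by
  constructor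
  · intro h s
    obtain ⟨x₂, hx₂⟩ := Ext.covariant_sequence_exact₃ _ hS
      ((Sheaf.H.equiv₀ S.X₃ isTerminalTop).symm s) (zero_add 1) (Subsingleton.elim _ _)
    refine ⟨Sheaf.H.equiv₀ S.X₂ isTerminalTop x₂, ?_⟩
    rw [Sheaf.H.equiv₀_naturality, Sheaf.H.map_apply, hx₂, AddEquiv.apply_symm_apply]
  · intro h
    refine subsingleton_of_forall_eq 0 fun x => ?_
    obtain ⟨x₃, rfl⟩ := Ext.covariant_sequence_exact₁ _ hS x (Subsingleton.elim _ _) (zero_add 1)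
    obtain ⟨t, ht⟩ := h (Sheaf.H.equiv₀ S.X₃ isTerminalTop x₃)
    have hx₃ : ((Sheaf.H.equiv₀ S.X₂ isTerminalTop).symm t).comp (Ext.mk₀ S.g) (add_zero 0) = x₃ := by
      rw [← Sheaf.H.map_apply, Sheaf.H.equiv₀_symm_naturality, ht, AddEquiv.symm_apply_apply]
    rw [← hx₃, Ext.comp_assoc_of_second_deg_zero, hS.comp_extClass, Ext.comp_zero]

end FlasqueShortExact

/-! ### Hartshorne III.2.5: flasque sheaves are acyclic -/

section Acyclic

variable {X : TopCat.{u}}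

/-- **Hartshorne III.2.5** (positive degrees written `n + 1`): if `ℱ` is a flasque sheaf of abelian
groups on a topological space `X`, then `Hⁿ⁺¹(X, ℱ) = 0` for all `n`. Proof as printed: embed `ℱ` in an
injective `ℐ` (enough injectives), which is flasque (III.2.4), so the quotient `𝒢` is flasque
(II, Ex. 1.16(c)); `H⁰(X, ℐ) → H⁰(X, 𝒢)` is onto (II, Ex. 1.16(b)) and `Hⁱ(X, ℐ) = 0` for `i > 0`, so
`H¹(X, ℱ) = 0` and `Hⁱ(X, ℱ) ≅ Hⁱ⁻¹(X, 𝒢)` for `i ≥ 2`; induction on `i` (for all flasque sheaves).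
[cite: Hartshorne1977, III.2.5] -/
theorem subsingleton_H_succ_of_isFlasque (F : Sheaf (Opens.grothendieckTopology X) AddCommGrpCat.{u})
    [TopCat.Sheaf.IsFlasque F] (n : ℕ) : Subsingleton (F.H (n + 1)) := by
  induction n generalizing F with
  | zero =>
    have hS : (ShortComplex.cokernelSequence (Injective.ι F)).ShortExact :=
      { exact := ShortComplex.cokernelSequence_exact _
        mono_f := Injective.ι_mono F }
    haveI : TopCat.Sheaf.IsFlasque (ShortComplex.cokernelSequence (Injective.ι F)).X₁ := ‹_›
    haveI : Injective (ShortComplex.cokernelSequence (Injective.ι F)).X₂ :=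
      Injective.injective_under F
    exact (subsingleton_H_one_iff_surjective hS).mpr (surjective_app_of_shortExact hS ⊤)
  | succ n ih =>
    have hS : (ShortComplex.cokernelSequence (Injective.ι F)).ShortExact :=
      { exact := ShortComplex.cokernelSequence_exact _
        mono_f := Injective.ι_mono F }
    haveI : TopCat.Sheaf.IsFlasque (ShortComplex.cokernelSequence (Injective.ι F)).X₁ := ‹_›
    haveI : Injective (ShortComplex.cokernelSequence (Injective.ι F)).X₂ :=
      Injective.injective_under F
    haveI : TopCat.Sheaf.IsFlasque (ShortComplex.cokernelSequence (Injective.ι F)).X₂ :=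
      isFlasque_of_injective _
    haveI : TopCat.Sheaf.IsFlasque (ShortComplex.cokernelSequence (Injective.ι F)).X₃ :=
      isFlasque_of_shortExact hS
    haveI := ih (ShortComplex.cokernelSequence (Injective.ι F)).X₃
    exact Ext.subsingleton_X₁ _ hS (n + 1)

/-- **Hartshorne III.2.5**: if `ℱ` is a flasque sheaf of abelian groups on a topological space `X`,
then `Hⁱ(X, ℱ) = 0` for all `i > 0` (`Hⁱ` is Mathlib's `Sheaf.H`, the derived functors of
`Γ(X, ·) = Hom(ℤ_X, ·)` computed as `Ext`-groups). [cite: Hartshorne1977, III.2.5] -/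
theorem subsingleton_H_of_isFlasque (F : Sheaf (Opens.grothendieckTopology X) AddCommGrpCat.{u})
    [TopCat.Sheaf.IsFlasque F] (i : ℕ) (hi : 0 < i) : Subsingleton (F.H i) := by
  obtain ⟨n, rfl⟩ := Nat.exists_eq_add_one_of_ne_zero hi.ne'
  exact subsingleton_H_succ_of_isFlasque F n

/-- **Hartshorne III.2.5**, phrased for Mathlib's `TopCat.Sheaf AddCommGrpCat X` (the form of the named
fact `Literature.AlgebraicGeometry.Motives.isFlasque_subsingleton_H` of `GrothendieckVanishing.lean`): a flasque sheaf of abelian groups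
has `Hⁱ(X, ℱ) = 0` for all `i > 0`. [cite: Hartshorne1977, III.2.5] -/
theorem subsingleton_H_of_isFlasque' (F : TopCat.Sheaf AddCommGrpCat.{u} X) [F.IsFlasque] (i : ℕ)
    (hi : 0 < i) : Subsingleton (F.H i) :=
  subsingleton_H_of_isFlasque F i hi

/-- **Hartshorne III.2.4**, phrased for Mathlib's `TopCat.Sheaf AddCommGrpCat X` (the form of the named
fact `Literature.AlgebraicGeometry.Motives.injective_isFlasque` of `GrothendieckVanishing.lean`): an injective sheaf of abelian groups
is flasque. [cite: Hartshorne1977, III.2.4] -/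
theorem isFlasque_of_injective' (I : TopCat.Sheaf AddCommGrpCat.{u} X) (hI : Injective I) :
    I.IsFlasque :=
  @isFlasque_of_injective _ I hI

end Acyclic

end Literature.AlgebraicGeometry.Motives
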